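import Summits.BirchSwinnertonDyer.BirchSwinnertonDyer.Theorems.ByReductionTypeAtTwoAdditivePotMultConjATwoNarrowRoadKit
import Summits.BirchSwinnertonDyer.BirchSwinnertonDyer.Theorems.ByReductionTypeAtTwoFineSelmerConjAAtTwoAdditivePotGoodChevalleyOneBitDoor
import Literature.NumberTheory.EllipticCurves.ZpExtensionRestrictCyclotomic
import HarnessLib

/-!
# C4″ `AdditivePotMultOverKAtTwo` (item stmt-BirchSwinnertonDyer-22618), the (I1M′) input on the `0 < Δ` rows:
# the NARROW-ROAD KIT, part B (SQUARES AND PARITY) — the non-square transfer `ℚ(θ) → A`, the parity of `h(A)` from the one-bit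
# currency and the residue non-square criterion of k4-w1's zero-hypothesis narrow-Fukuda road (`conjA_two_445508b1''`)

Cell `bsd-2adic`, rung K4, seat `bsd-2adic-k4-w3` GEN 12 (explicit unit of director-bsd g16 (309)(7); `--supports stmt-BirchSwinnertonDyer-22618`).
HONEST FRAMING (D-0036/D-0054/D-0152): THEOREMS ONLY (no definition, no named fact, no `sorry`, no instance). Generic plumbing; closes
nothing at the `∀`-level (C4″ / (I1M′) stay research-open); nothing booked; BSD is not proved by any of this.

THE ROAD (k4-w1 GEN 10, row `445508b1`; cruxlead-19573-w2 GEN 9 NARROW FUKUDA). For a census cubic model `y² = x³ + px² + qx + r`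
with irreducible cubic and TOTALLY REAL `2`-torsion field `E = ℚ(β) = ℚ(θ)` (`θ` a root of a reduced generator of the same field):
Fukuda index `0` for every cyclotomic `ℤ₂`-extension of `E` and ONE equality of narrow `2`-ranks
`[Cl⁺(A) : Cl⁺(A)²] = [Cl⁺(E) : Cl⁺(E)²]`, `A = E ⊔ ℚ_1 = E(√2)`, give Coates–Sujatha's statement (A) at `(W, 2)`
(`conjA_two_of_pointField_of_narrowRank_sqrtTwo_model`). Both indices are computed as `#(U⁺/U²)` once `h` is odd
(`index_range_pow_two_narrowClassGroup_eq_card_totPosUnitsModSq_of_odd_classNumber`). This file makes every step that does not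
depend on the particular cubic a theorem with the cubic `⟨1, p, q, r⟩` as a parameter:

Part A (`…NarrowRoadKit`): §0 helpers, §1 layer basics/embeddings. Part C (`…NarrowRoadKitDoors`): §6 assemblies, §5 the door. This part:

* §2 `not_exists_sq_eq_map_of_not_exists_sq` — a unit of `E` that is not a unit square in `E` is not one in `A` (`σ`-trick + norm).
* §3 `odd_classNumber_sup_layer_one_of_layerOneBit` — `h(A)` odd from k4-w1's ONE-BIT currency
  `∀ κL cyclotomic, classNumberPExp κL 1 = 0` (Chevalley's door at `2`, certified by `layerOneBit_of_chevalleyCert`), transported along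
  `(κ|_E)_1 ≃ E ⊔ ℚ_1` (`classNumber_eq_of_ringEquiv'`).
* §4 `not_exists_sq_eq_of_residue` — a unit `≡ c (mod π)`, `|N(π)| = ℓ` prime, `c` a non-residue mod `ℓ`, is not a unit square
  (k4-w1's `…_of_absNorm_eq_three` with `ℓ`, `c` freed).

References: [Fukuda1994] Thm. 1 (2), p. 264; [CoatesSujatha2005] Conj. A, Thm. 3.4; [FrohlichTaylor1990] Ch. V §1 (1.8)–(1.13);
[Washington1997] §13.1, Prop. 13.2; [Lang1990] Ch. 13 §4 Lemma 4.1; [Cohen1993] §4.1.3; [Marcus1977] Ch. 5 Thm. 22.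
-/

set_option autoImplicit false
-- sibling precedent (`…NarrowRankStamp445508b1.lean`): the directory name repeats the summit name
set_option linter.dupNamespace false

noncomputable section

open scoped Classical IntermediateField NumberField

namespace Summit.BirchSwinnertonDyer.BirchSwinnertonDyer.Theorems.AddKatoTwo

open WeierstrassCurve Field Polynomial IsDedekindDomain NumberField IntermediateField Literature.NumberTheory.EllipticCurves
  Literature.NumberTheory.EllipticCurves.ZpExtension
  Literature.NumberTheory.GaloisRepresentations Literature.NumberTheory.IwasawaTheory Literature.NumberTheory.NumberFields
  Literature.Geometry.Kaehler.ComplexTorus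
  Summit.BirchSwinnertonDyer.BirchSwinnertonDyer.Theorems.AlignedTransportAtTwoTorsionPointField
  Summit.BirchSwinnertonDyer.BirchSwinnertonDyer.Theorems.SteinbergFibreAtTwo.NarrowRankCert

/-! ## §2 A non-square unit of `ℚ(θ)` stays a non-square unit in `A` -/

section NonSquare

variable {p q r : ℤ} {θ : AlgebraicClosure ℚ}

set_option maxHeartbeats 400000 in
/-- **A unit `u` of `𝓞 ℚ(θ)` that is not the square of a unit of `𝓞 ℚ(θ)` is not the square of a unit of `𝓞 A`, `A = ℚ(θ) ⊔ ℚ_1`**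
(`ℚ(θ)` a totally real cubic field): via the non-trivial automorphism `σ` of the quadratic extension `A/ℚ(θ)` (`σ√2 = −√2`): `σw = ±w`
for a square root `w`; `σw = w` puts `w` in `ℚ(θ)` (excluded by hypothesis); `σw = −w` puts `w√2` in `ℚ(θ)` with square `2u`, whose
`ℚ`-norm is `8·N(u) = ±8`, not a rational square. Stated for any unit `e` of `𝓞 A` whose value is the image of `u`.
k4-w1's `not_exists_sq_eq_u0_sup_layer_one_d63644` with the cubic and the unit freed. [cite: Cohen1993, §4.1.3]
[cite: FrohlichTaylor1990, Ch. V §1 (1.12), p. 164] -/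
theorem not_exists_sq_eq_map_of_not_exists_sq (hirr : Irreducible (Cubic.toPoly ⟨1, (p : ℚ), q, r⟩))
    (hθ : aeval θ (Cubic.toPoly ⟨1, (p : ℚ), q, r⟩) = 0)
    (hreal : haveI : FiniteDimensional ℚ ↥ℚ⟮θ⟯ :=
        IntermediateField.adjoin.finiteDimensional ⟨_, Cubic.monic_of_a_eq_one', by rwa [← aeval_def]⟩
      haveI : NumberField ↥ℚ⟮θ⟯ := NumberField.mk
      IsTotallyReal ↥ℚ⟮θ⟯)
    {t : AlgebraicClosure ℚ} (ht : t ∈ (CyclotomicZp.zpExtension 2).layer 1) (ht2 : t ^ 2 = 2)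
    (uE : haveI : FiniteDimensional ℚ ↥ℚ⟮θ⟯ :=
        IntermediateField.adjoin.finiteDimensional ⟨_, Cubic.monic_of_a_eq_one', by rwa [← aeval_def]⟩
      (𝓞 ↥ℚ⟮θ⟯)ˣ)
    (hnsK : ¬ ∃ w : (𝓞 ↥ℚ⟮θ⟯)ˣ, uE = w ^ 2)
    (e : haveI : FiniteDimensional ℚ ↥ℚ⟮θ⟯ :=
        IntermediateField.adjoin.finiteDimensional ⟨_, Cubic.monic_of_a_eq_one', by rwa [← aeval_def]⟩
      haveI : FiniteDimensional ℚ ↥((CyclotomicZp.zpExtension 2).layer 1) :=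
        (CyclotomicZp.zpExtension 2).finiteDimensional_layer_holds 1
      (𝓞 ↥(ℚ⟮θ⟯ ⊔ (CyclotomicZp.zpExtension 2).layer 1))ˣ)
    (he : ((e : 𝓞 ↥(ℚ⟮θ⟯ ⊔ (CyclotomicZp.zpExtension 2).layer 1)) : ↥(ℚ⟮θ⟯ ⊔ (CyclotomicZp.zpExtension 2).layer 1)) =
      inclusion (le_sup_left : ℚ⟮θ⟯ ≤ ℚ⟮θ⟯ ⊔ (CyclotomicZp.zpExtension 2).layer 1) ((uE : 𝓞 ↥ℚ⟮θ⟯) : ↥ℚ⟮θ⟯)) :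
    ¬ ∃ ε : (𝓞 ↥(ℚ⟮θ⟯ ⊔ (CyclotomicZp.zpExtension 2).layer 1))ˣ, e = ε ^ 2 := by
  haveI : FiniteDimensional ℚ ↥ℚ⟮θ⟯ :=
    IntermediateField.adjoin.finiteDimensional ⟨_, Cubic.monic_of_a_eq_one', by rwa [← aeval_def]⟩
  haveI : FiniteDimensional ℚ ↥((CyclotomicZp.zpExtension 2).layer 1) := (CyclotomicZp.zpExtension 2).finiteDimensional_layer_holds 1
  haveI : NumberField ↥ℚ⟮θ⟯ := NumberField.mk
  haveI : NumberField ↥(ℚ⟮θ⟯ ⊔ (CyclotomicZp.zpExtension 2).layer 1) := NumberField.mk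
  obtain ⟨-, hfinA, h3⟩ := layer_one_basics hirr hθ hreal
  haveI : IsTotallyReal ↥ℚ⟮θ⟯ := hreal
  rintro ⟨ε, hε⟩
  have hKA : ℚ⟮θ⟯ ≤ ℚ⟮θ⟯ ⊔ ((CyclotomicZp.zpExtension 2).layer 1) := le_sup_left
  have htA : t ∈ ℚ⟮θ⟯ ⊔ ((CyclotomicZp.zpExtension 2).layer 1) := (le_sup_right : ((CyclotomicZp.zpExtension 2).layer 1) ≤ ℚ⟮θ⟯ ⊔ ((CyclotomicZp.zpExtension 2).layer 1)) ht
  set t' : ↥(ℚ⟮θ⟯ ⊔ ((CyclotomicZp.zpExtension 2).layer 1)) := ⟨t, htA⟩ with ht'def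
  have ht'2 : t' ^ 2 = 2 := by
    apply (algebraMap ↥(ℚ⟮θ⟯ ⊔ ((CyclotomicZp.zpExtension 2).layer 1)) (AlgebraicClosure ℚ)).injective
    rw [map_pow, map_ofNat]
    exact ht2
  letI : Algebra ℚ⟮θ⟯ ↥(ℚ⟮θ⟯ ⊔ ((CyclotomicZp.zpExtension 2).layer 1)) := (inclusion hKA).toRingHom.toAlgebra
  have halg : ∀ c : ℚ⟮θ⟯, algebraMap ℚ⟮θ⟯ ↥(ℚ⟮θ⟯ ⊔ ((CyclotomicZp.zpExtension 2).layer 1)) c = inclusion hKA c := fun _ => rfl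
  haveI : IsScalarTower ℚ ℚ⟮θ⟯ ↥(ℚ⟮θ⟯ ⊔ ((CyclotomicZp.zpExtension 2).layer 1)) := IsScalarTower.of_algebraMap_eq fun q => ((inclusion hKA).commutes q).symm
  haveI : Module.Finite ℚ⟮θ⟯ ↥(ℚ⟮θ⟯ ⊔ ((CyclotomicZp.zpExtension 2).layer 1)) := Module.Finite.of_restrictScalars_finite ℚ ℚ⟮θ⟯ _
  have hdeg : Module.finrank ℚ⟮θ⟯ ↥(ℚ⟮θ⟯ ⊔ ((CyclotomicZp.zpExtension 2).layer 1)) = 2 := by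
    have htower := Module.finrank_mul_finrank ℚ ℚ⟮θ⟯ ↥(ℚ⟮θ⟯ ⊔ ((CyclotomicZp.zpExtension 2).layer 1))
    rw [h3, hfinA] at htower
    omega
  haveI : Algebra.IsQuadraticExtension ℚ⟮θ⟯ ↥(ℚ⟮θ⟯ ⊔ ((CyclotomicZp.zpExtension 2).layer 1)) := ⟨hdeg⟩
  haveI : IsGalois ℚ⟮θ⟯ ↥(ℚ⟮θ⟯ ⊔ ((CyclotomicZp.zpExtension 2).layer 1)) := inferInstance
  set w : ↥(ℚ⟮θ⟯ ⊔ ((CyclotomicZp.zpExtension 2).layer 1)) := ((ε : 𝓞 ↥(ℚ⟮θ⟯ ⊔ ((CyclotomicZp.zpExtension 2).layer 1))) : ↥(ℚ⟮θ⟯ ⊔ ((CyclotomicZp.zpExtension 2).layer 1))) with hwdef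
  have hw2 : w ^ 2 = algebraMap ℚ⟮θ⟯ ↥(ℚ⟮θ⟯ ⊔ ((CyclotomicZp.zpExtension 2).layer 1)) ((uE : 𝓞 ℚ⟮θ⟯) : ℚ⟮θ⟯) := by
    rw [hwdef, halg, ← he, hε, Units.val_pow_eq_pow_val]; push_cast; ring
  -- the non-trivial automorphism
  have hcard : Fintype.card (↥(ℚ⟮θ⟯ ⊔ ((CyclotomicZp.zpExtension 2).layer 1)) ≃ₐ[ℚ⟮θ⟯] ↥(ℚ⟮θ⟯ ⊔ ((CyclotomicZp.zpExtension 2).layer 1))) = 2 := by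
    rw [← Nat.card_eq_fintype_card, IsGalois.card_aut_eq_finrank, hdeg]
  haveI : Nontrivial (↥(ℚ⟮θ⟯ ⊔ ((CyclotomicZp.zpExtension 2).layer 1)) ≃ₐ[ℚ⟮θ⟯] ↥(ℚ⟮θ⟯ ⊔ ((CyclotomicZp.zpExtension 2).layer 1))) := Fintype.one_lt_card_iff_nontrivial.mp (by rw [hcard]; norm_num)
  obtain ⟨σ, hσ1⟩ := exists_ne (1 : ↥(ℚ⟮θ⟯ ⊔ ((CyclotomicZp.zpExtension 2).layer 1)) ≃ₐ[ℚ⟮θ⟯] ↥(ℚ⟮θ⟯ ⊔ ((CyclotomicZp.zpExtension 2).layer 1)))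
  have hall : ∀ f : ↥(ℚ⟮θ⟯ ⊔ ((CyclotomicZp.zpExtension 2).layer 1)) ≃ₐ[ℚ⟮θ⟯] ↥(ℚ⟮θ⟯ ⊔ ((CyclotomicZp.zpExtension 2).layer 1)), f = 1 ∨ f = σ := by
    intro f
    by_contra hf
    push Not at hf
    have h3' : ({1, σ, f} : Finset (↥(ℚ⟮θ⟯ ⊔ ((CyclotomicZp.zpExtension 2).layer 1)) ≃ₐ[ℚ⟮θ⟯] ↥(ℚ⟮θ⟯ ⊔ ((CyclotomicZp.zpExtension 2).layer 1)))).card = 3 := by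
      rw [Finset.card_insert_of_notMem, Finset.card_pair hf.2.symm]
      simp only [Finset.mem_insert, Finset.mem_singleton, not_or]
      exact ⟨hσ1.symm, hf.1.symm⟩
    have := Finset.card_le_univ ({1, σ, f} : Finset (↥(ℚ⟮θ⟯ ⊔ ((CyclotomicZp.zpExtension 2).layer 1)) ≃ₐ[ℚ⟮θ⟯] ↥(ℚ⟮θ⟯ ⊔ ((CyclotomicZp.zpExtension 2).layer 1))))
    rw [h3', hcard] at this
    omega
  have hfix : ∀ z : ↥(ℚ⟮θ⟯ ⊔ ((CyclotomicZp.zpExtension 2).layer 1)), σ z = z → z ∈ Set.range (algebraMap ℚ⟮θ⟯ ↥(ℚ⟮θ⟯ ⊔ ((CyclotomicZp.zpExtension 2).layer 1))) := by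
    intro z hz
    refine (IsGalois.mem_range_algebraMap_iff_fixed z).mpr fun f => ?_
    rcases hall f with rfl | rfl
    · rfl
    · exact hz
  -- `t' ∉ ℚ⟮θ⟯`, `A = ℚ⟮θ⟯(t')`, `σ t' = −t'`
  have htK : t' ∉ Set.range (algebraMap ℚ⟮θ⟯ ↥(ℚ⟮θ⟯ ⊔ ((CyclotomicZp.zpExtension 2).layer 1))) :=
    sqrt_two_not_mem_range hirr hθ hreal ht ht2
  have htint : IsIntegral ℚ⟮θ⟯ t' := (Algebra.IsIntegral.isIntegral (R := ℚ) t').tower_top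
  have hgen : IntermediateField.adjoin ℚ⟮θ⟯ ({t'} : Set ↥(ℚ⟮θ⟯ ⊔ ((CyclotomicZp.zpExtension 2).layer 1))) = ⊤ := by
    have h2le : 2 ≤ (minpoly ℚ⟮θ⟯ t').natDegree := (minpoly.two_le_natDegree_iff htint).mpr htK
    refine IntermediateField.eq_of_le_of_finrank_eq le_top ?_
    rw [IntermediateField.adjoin.finrank htint, IntermediateField.finrank_top', hdeg]
    exact le_antisymm ((minpoly.natDegree_le (A := ↥ℚ⟮θ⟯) (x := t')).trans hdeg.le) h2le
  have hpoly : ∀ z : ↥(ℚ⟮θ⟯ ⊔ ((CyclotomicZp.zpExtension 2).layer 1)), ∃ f : ℚ⟮θ⟯[X], z = aeval t' f := by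
    intro z
    have hz : z ∈ (IntermediateField.adjoin ℚ⟮θ⟯ ({t'} : Set ↥(ℚ⟮θ⟯ ⊔ ((CyclotomicZp.zpExtension 2).layer 1)))).toSubalgebra := by
      rw [hgen, IntermediateField.top_toSubalgebra]; exact Algebra.mem_top
    rw [IntermediateField.adjoin_simple_toSubalgebra_of_isAlgebraic htint.isAlgebraic, Algebra.adjoin_singleton_eq_range_aeval] at hz
    obtain ⟨f, hf⟩ := hz
    exact ⟨f, hf.symm⟩
  have hσt : σ t' = -t' := by
    have hsq : (σ t') ^ 2 = t' ^ 2 := by rw [← map_pow, ht'2, map_ofNat]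
    rcases sq_eq_sq_iff_eq_or_eq_neg.mp hsq with h | h
    · exfalso
      apply hσ1
      refine AlgEquiv.ext fun z => ?_
      obtain ⟨f, rfl⟩ := hpoly z
      rw [AlgEquiv.one_apply, ← Polynomial.aeval_algHom_apply, h]
    · exact h
  have hσw : σ w = w ∨ σ w = -w := by
    have hsq : (σ w) ^ 2 = w ^ 2 := by rw [← map_pow, hw2, AlgEquiv.commutes]
    exact sq_eq_sq_iff_eq_or_eq_neg.mp hsq
  rcases hσw with h | h
  · -- `w ∈ ℚ⟮θ⟯`: a unit square root of `u` in `𝓞 ℚ⟮θ⟯`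
    obtain ⟨c, hc⟩ := hfix w h
    have hc2 : c ^ 2 = ((uE : 𝓞 ℚ⟮θ⟯) : ℚ⟮θ⟯) := by
      apply (algebraMap ℚ⟮θ⟯ ↥(ℚ⟮θ⟯ ⊔ ((CyclotomicZp.zpExtension 2).layer 1))).injective; rw [map_pow, hc, hw2]
    have hcint : IsIntegral ℤ c := by
      refine IsIntegral.of_pow two_pos ?_
      rw [hc2]; exact (uE : 𝓞 ℚ⟮θ⟯).2
    set c' : 𝓞 ℚ⟮θ⟯ := ⟨c, hcint⟩ with hc'def
    have hc'2 : c' ^ 2 = (uE : 𝓞 ℚ⟮θ⟯) := by ext; simp [hc'def, hc2]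
    have hcu : c' * (c' * ((uE⁻¹ : (𝓞 ℚ⟮θ⟯)ˣ) : 𝓞 ℚ⟮θ⟯)) = 1 := by
      rw [← mul_assoc, ← sq, hc'2, Units.mul_inv]
    exact hnsK ⟨Units.mkOfMulEqOne c' _ hcu,
      Units.ext (by rw [Units.val_pow_eq_pow_val, Units.val_mkOfMulEqOne (a := c'), hc'2])⟩
  · -- `w t' ∈ ℚ⟮θ⟯` with square `2 u`: norm obstruction
    have hfix' : σ (w * t') = w * t' := by rw [map_mul, h, hσt]; ring
    obtain ⟨c, hc⟩ := hfix (w * t') hfix'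
    have hc2 : c ^ 2 = 2 * ((uE : 𝓞 ℚ⟮θ⟯) : ℚ⟮θ⟯) := by
      apply (algebraMap ℚ⟮θ⟯ ↥(ℚ⟮θ⟯ ⊔ ((CyclotomicZp.zpExtension 2).layer 1))).injective
      rw [map_pow, hc, mul_pow, hw2, ht'2, map_mul, map_ofNat]; ring
    have hN := congrArg (Algebra.norm ℚ) hc2
    rw [map_pow, map_mul, show (2 : ℚ⟮θ⟯) = algebraMap ℚ ℚ⟮θ⟯ 2 from (map_ofNat _ 2).symm, Algebra.norm_algebraMap, h3,
      ← Algebra.coe_norm_int] at hN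
    have hunit : IsUnit (Algebra.norm ℤ (uE : 𝓞 ℚ⟮θ⟯)) := uE.isUnit.map _
    rcases Int.isUnit_iff.mp hunit with h1 | h1
    · rw [h1] at hN; norm_num at hN; exact rat_sq_ne_eight _ hN
    · rw [h1] at hN; norm_num at hN; nlinarith [sq_nonneg (Algebra.norm ℚ c)]

end NonSquare

/-! ## §3 `h(A)` odd from the one-bit currency, and the two narrow indices -/

section Parity

variable {p q r : ℤ} {θ : AlgebraicClosure ℚ}

/-- The class number is invariant under ring isomorphism of number fields (Mathlib `ClassGroup.mulEquiv`,
`NumberField.RingOfIntegers.mapRingEquiv`). [folklore] -/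
theorem classNumber_eq_of_ringEquiv' {K K' : Type*} [Field K] [NumberField K] [Field K'] [NumberField K'] (e : K ≃+* K') :
    NumberField.classNumber K = NumberField.classNumber K' := by
  unfold NumberField.classNumber
  exact Fintype.card_congr (ClassGroup.mulEquiv (NumberField.RingOfIntegers.mapRingEquiv e)).toEquiv

set_option maxHeartbeats 400000 in
/-- **`h(ℚ(θ) ⊔ ℚ_1)` is ODD from the ONE-BIT currency** of k4-w1's Chevalley door at `2`: if every cyclotomic `ℤ₂`-extension `κL` of
the cubic field `ℚ(θ)` has `classNumberPExp κL 1 = 0` (`2 ∤ h` of its first layer — `layerOneBit_of_chevalleyCert`), then the class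
number of the intermediate field `ℚ(θ) ⊔ ℚ_1 ⊂ ℚ̄` is odd: the restriction `κ|_{ℚ(θ)}` of the cyclotomic `ℤ₂`-extension of `ℚ` (odd
degree) is cyclotomic (`isCyclotomic_restrict`) and its first layer is `≅ ℚ(θ) ⊔ ℚ_1`
(`nonempty_algEquiv_layer_restrict_fieldRange_sup_layer`). [cite: Washington1997, §13.1] [cite: Lang1990, Ch. 13 §4, Lemma 4.1] -/
theorem odd_classNumber_sup_layer_one_of_layerOneBit (hirr : Irreducible (Cubic.toPoly ⟨1, (p : ℚ), q, r⟩))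
    (hθ : aeval θ (Cubic.toPoly ⟨1, (p : ℚ), q, r⟩) = 0)
    (h1 : haveI : FiniteDimensional ℚ (IntermediateField.adjoin ℚ {θ}) :=
        IntermediateField.adjoin.finiteDimensional ((AlgebraicClosure.isAlgebraic ℚ).isAlgebraic θ).isIntegral
      haveI : NumberField (IntermediateField.adjoin ℚ {θ}) := NumberField.mk
      ∀ κL : ZpExtension (IntermediateField.adjoin ℚ {θ}) 2, κL.IsCyclotomic → classNumberPExp κL 1 = 0) :
    haveI : FiniteDimensional ℚ ↥ℚ⟮θ⟯ :=
      IntermediateField.adjoin.finiteDimensional ⟨_, Cubic.monic_of_a_eq_one', by rwa [← aeval_def]⟩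
    haveI : FiniteDimensional ℚ ↥((CyclotomicZp.zpExtension 2).layer 1) := (CyclotomicZp.zpExtension 2).finiteDimensional_layer_holds 1
    haveI : NumberField ↥(ℚ⟮θ⟯ ⊔ (CyclotomicZp.zpExtension 2).layer 1) := NumberField.mk
    Odd (classNumber ↥(ℚ⟮θ⟯ ⊔ (CyclotomicZp.zpExtension 2).layer 1)) := by
  haveI : FiniteDimensional ℚ ↥ℚ⟮θ⟯ :=
    IntermediateField.adjoin.finiteDimensional ⟨_, Cubic.monic_of_a_eq_one', by rwa [← aeval_def]⟩
  haveI : FiniteDimensional ℚ ↥((CyclotomicZp.zpExtension 2).layer 1) := (CyclotomicZp.zpExtension 2).finiteDimensional_layer_holds 1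
  haveI : NumberField ↥ℚ⟮θ⟯ := NumberField.mk
  haveI : NumberField ↥(ℚ⟮θ⟯ ⊔ (CyclotomicZp.zpExtension 2).layer 1) := NumberField.mk
  set κ := CyclotomicZp.zpExtension 2 with hκdef
  have h3 : Module.finrank ℚ ↥ℚ⟮θ⟯ = 3 := finrank_adjoin_eq_three_of_irreducible hirr hθ
  have hodd3 : Odd (Module.finrank ℚ ↥ℚ⟮θ⟯) := by rw [h3]; decide
  have hsurj := surjective_comp_absGaloisRestrict_cyclotomicZp_of_odd ℚ⟮θ⟯ hodd3
  set κE := κ.restrict ↥ℚ⟮θ⟯ hsurj with hκE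
  haveI : FiniteDimensional ↥ℚ⟮θ⟯ (κE.layer 1) := κE.finiteDimensional_layer_holds 1
  haveI : NumberField (κE.layer 1) := NumberField.of_module_finite ↥ℚ⟮θ⟯ _
  obtain ⟨f⟩ := nonempty_algEquiv_layer_restrict_fieldRange_sup_layer κ ↥ℚ⟮θ⟯ hsurj (ℚ⟮θ⟯).val 1
  have hrange : (ℚ⟮θ⟯).val.fieldRange ⊔ κ.layer 1 = ℚ⟮θ⟯ ⊔ κ.layer 1 := by rw [fieldRange_val]
  set e : ↥(κE.layer 1) ≃ₐ[ℚ] ↥(ℚ⟮θ⟯ ⊔ κ.layer 1) := f.trans (equivOfEq hrange) with hedef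
  have hcyc : κE.IsCyclotomic := ZpExtension.isCyclotomic_restrict κ (CyclotomicZp.isCyclotomic_zpExtension 2) ↥ℚ⟮θ⟯ hsurj
  have h0 : classNumberPExp κE 1 = 0 := h1 κE hcyc
  rw [classNumberPExp_eq_padicValNat_classNumber, padicValNat.eq_zero_iff] at h0
  rw [← classNumber_eq_of_ringEquiv' e.toRingEquiv, Nat.odd_iff]
  rcases h0 with h | h | h
  · norm_num at h
  · exact absurd h (NumberField.classNumber_ne_zero _)
  · omega

end Parity

/-! ## §4 A unit that is a quadratic non-residue modulo a principal prime is not a unit square -/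

section Residue

variable {K : Type} [Field K] [NumberField K]

/-- **A unit `u ≡ c (mod π)` with `|N(π)| = ℓ` prime and `c` a quadratic non-residue mod `ℓ` is not the square of a unit**:
`𝓞 K/(π)` is a ring with `ℓ` elements (`≅ ℤ/ℓ`), where `c` is not a square. k4-w1's `not_exists_sq_eq_of_absNorm_eq_three` with
`ℓ` and `c` freed (the non-residue hypothesis is decidable). [cite: Marcus1977, Ch. 5 Thm. 22 (c) (`‖(α)‖ = |N(α)|`)] [cite: Cohen1993, §4.1.3] -/
theorem not_exists_sq_eq_of_residue (u : (𝓞 K)ˣ) (π : 𝓞 K) {ℓ : ℕ} (hℓ : ℓ.Prime) (hπ : (Algebra.norm ℤ π).natAbs = ℓ)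
    (c : ℤ) (hcong : (u : 𝓞 K) - c ∈ Ideal.span {π}) (hnr : ∀ z : ZMod ℓ, z ^ 2 ≠ (c : ZMod ℓ)) :
    ¬ ∃ ε : (𝓞 K)ˣ, u = ε ^ 2 := by
  rintro ⟨ε, hε⟩
  set I : Ideal (𝓞 K) := Ideal.span {π} with hI
  have hIℓ : Ideal.absNorm I = ℓ := by rw [hI, Ideal.absNorm_span_singleton, hπ]
  have hcard : Nat.card (𝓞 K ⧸ I) = ℓ := by rw [← Submodule.cardQuot_apply, ← Ideal.absNorm_apply, hIℓ]
  haveI : Finite (𝓞 K ⧸ I) := Nat.finite_of_card_ne_zero (by rw [hcard]; exact hℓ.ne_zero)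
  letI : Fintype (𝓞 K ⧸ I) := Fintype.ofFinite _
  have hcard' : Fintype.card (𝓞 K ⧸ I) = ℓ := by rw [← Nat.card_eq_fintype_card, hcard]
  set ψ : ZMod ℓ ≃+* 𝓞 K ⧸ I := ZMod.ringEquivOfPrime (𝓞 K ⧸ I) hℓ hcard' with hψ
  -- in the quotient, `ε̄² = ū = c̄`
  have hq : Ideal.Quotient.mk I ((ε : 𝓞 K) ^ 2) = (c : 𝓞 K ⧸ I) := by
    have h1 : (ε : 𝓞 K) ^ 2 = (u : 𝓞 K) := by rw [hε, Units.val_pow_eq_pow_val]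
    rw [h1, ← sub_eq_zero, ← map_intCast (Ideal.Quotient.mk I), ← map_sub, Ideal.Quotient.eq_zero_iff_mem]
    exact hcong
  set w : ZMod ℓ := ψ.symm (Ideal.Quotient.mk I (ε : 𝓞 K)) with hw
  have hw2 : w ^ 2 = (c : ZMod ℓ) := by
    rw [hw, ← map_pow, ← map_pow, hq, map_intCast]
  exact hnr w hw2

end Residue

end Summit.BirchSwinnertonDyer.BirchSwinnertonDyer.Theorems.AddKatoTwo

end
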